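import Literature.AnabelianGeometry.SemiGraphs.PSCSeparatingCoveringsLevelEdges
import Literature.AnabelianGeometry.SemiGraphs.PSCTwoComponentAffineShape
import Literature.AnabelianGeometry.SemiGraphs.ProSigmaCompletionInjective
import Literature.AnabelianGeometry.SemiGraphs.ProSigmaUnmarkedNodeMalnormal
import Literature.GroupTheory.CombinatorialGroupTheory.PuncturedSurfaceGroupUnmarkedLevelNielsen
import Literature.GroupTheory.CombinatorialGroupTheory.PuncturedSurfaceGroupUnmarkedLevelCertificates
import HarnessLib

/-!
# [CombGC] Prop. 1.2, proof p. 9: EDGE-LIKE separating coverings at two-component data with `C₁` UNMARKED (row F-2827)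

Mochizuki, *A combinatorial version of the Grothendieck conjecture*, Tohoku Math. J. **59** (2007)
[CombGC], PROOF of Proposition 1.2, author's manuscript p. 9, the resp'd (edge) case ("[possibly replacing
`G` by some finite étale covering of `G`] … there exists a finite étale … `Π_G`-covering `G' → G` whose
restriction to the anabelioid `G_{e₂}` is trivial, but whose restriction to the anabelioid `G_{e₁}` is
nontrivial") [cite: MochizukiCombGC2007, Prop 1.2 proof p.9].  Typed LEVEL-WISE as
`PSCDatum.EdgeLikeSeparatingCoverings` (abc-iut-w4-d081; abc-iut FACT-LIST row F-2827, the edge conjunct of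
F-2829; universal closure refuted; instance forms at genuine carriers are the content).

PROOF-ONLY file (abc-iut-f-166 gen 5): the data of two-component shape with the second component UNMARKED
(abc-iut-f-164 gen 2, `PSCTwoComponentUnmarkedOrigin.lean`), `r ≥ 2` marked points, all on `C₀`; the node
group `Π_ν = cl ι⟨ε⟩`, `ε = w⁻¹`, `w = ∏_{i≥g₀}[a_i,b_i]`, is generated by a product of commutators — a member
of NO free basis of `Γ_{g,r}` (abc-iut-f-166 gen 3's rank-one free-factor engine does not apply).  Instance of
the shape-independent level assembly `edgeLikeSeparatingCoverings_of_levelCertificates`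
(`PSCSeparatingCoveringsLevelEdges.lean`): LEVEL `K = Ker(χ : Γ → ℤ/ℓ², a_{g₀} ↦ 1)` (one handle of `C₁`
unwrapped; `ℓ ∈ Σ`, so `[Γ : K] = ℓ²` is a `Σ`-integer and `K = ι⁻¹(Π₀)` for an open `Π₀ ⊴ Π`); abc-iut-w5-d174's
Schreier basis of `K`; `w`, `c_0` and the `c_{j+1}` are members of free bases of `K`
(`PuncturedSurfaceGroupUnmarkedLevelNielsen.lean`); the nine abelian certificates of
`PuncturedSurfaceGroupUnmarkedLevelCertificates.lean`.

* `edgeLikeSeparatingCoverings_of_twoComponentUnmarked` — **row F-2827 at every two-component datum with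
  `C₁` unmarked and `r ≥ 2`**;
* `twoComponentUnmarkedOrigin_edgeLikeSeparatingCoverings` — the same at every origin of such data (gen 2's
  origin hypothesis BY NAME, intersected with `2 ≤ r`).

HONEST SCOPE: `r = 1` (the single cusp `c_0 = (∏_i[a_i,b_i])⁻¹` is itself a boundary word; two of the nine
level certificates become non-abelian) is not treated here.  A shape instance is consistency evidence for the
typed schema, not the printed statement for all pointed stable curves.  0 definitions; nothing here takes a
side on [IUTchIII] Cor. 3.12.
-/

noncomputable section

namespace Literature.AnabelianGeometry.SemiGraphs

namespace PSCDatum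

open scoped Pointwise
open Multiplicative
open Literature.GroupTheory.CombinatorialGroupTheory
open Literature.GroupTheory.CombinatorialGroupTheory.PuncturedSurfaceGroup (a b c cuspInertia
  exists_freeGroupBasis_elim_zero nodeLoop_eq_inv_of_unmarked levelCharacter_basis
  secondHandleProd_mem_levelKer c_mem_levelKer exists_levelBasis_secondHandleProd exists_levelBasis_cuspZero
  levelBasis_zero_cusp exists_certificate_node_node exists_certificate_node_cuspSucc
  exists_certificate_node_cuspZero exists_certificate_cuspSucc_node exists_certificate_cuspSucc_cuspSucc
  exists_certificate_cuspSucc_cuspZero exists_certificate_cuspZero_node exists_certificate_cuspZero_cuspSucc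
  exists_certificate_cuspZero_cuspZero exists_handleCuspCharacter)
open SemiGraphOfAnabelioids (IsProSigmaCompletion)
open SemiGraphOfAnabelioids.IsProSigmaCompletion (normal_of_comap_normal isSigmaInteger_prime_pow)

section Datum

variable {P : Type} [Group P] [TopologicalSpace P] [IsTopologicalGroup P]
variable [CompactSpace P] [TotallyDisconnectedSpace P] {Sigma : Set ℕ} {g r : ℕ}

/-- Transport of a certificate along equal underlying words. [cite: MochizukiCombGC2007, Prop 1.2 proof p.9] -/
theorem exists_hom_congr_of_eq {Γ : Type} [Group Γ] {K : Subgroup Γ} {M : Type} [Group M]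
    {u₁ u₁' u₂ u₂' : Γ} (e₁ : u₁ = u₁') (e₂ : u₂ = u₂') {h₁ : u₁ ∈ K} {h₂ : u₂ ∈ K} (h₁' : u₁' ∈ K)
    (h₂' : u₂' ∈ K) (H : ∃ ψ : K →* M, ψ ⟨u₁', h₁'⟩ = 1 ∧ ψ ⟨u₂', h₂'⟩ ≠ 1) :
    ∃ ψ : K →* M, ψ ⟨u₁, h₁⟩ = 1 ∧ ψ ⟨u₂, h₂⟩ ≠ 1 := by
  subst e₁ e₂; exact H

/-- **[CombGC] Prop. 1.2 proof p. 9, row F-2827 `EdgeLikeSeparatingCoverings`, at every two-component datum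
with `C₁` UNMARKED** (`s = 0`, `r ≥ 2`, `g − g₀ ≥ 1`; gen-2 shape hypotheses verbatim), with the separating
level `V' := V ∩ Π₀`, `Π₀` the open normal level `ι⁻¹(Π₀) = Ker(a_{g₀} ↦ ℤ/ℓ²)`.
[cite: MochizukiCombGC2007, Prop 1.2 proof p.9] -/
theorem edgeLikeSeparatingCoverings_of_twoComponentUnmarked (hne : Sigma.Nonempty)
    (hprime : ∀ p ∈ Sigma, p.Prime) (ι : PuncturedSurfaceGroup g r →* P)
    (hι : IsProSigmaCompletion Sigma ι) (G : PSCDatum P) {g₀ s : ℕ} (hg₀ : g₀ ≤ g) (hs : s = 0)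
    (hr : 2 ≤ r) (hg₁ : 1 ≤ g - g₀) (e : G.graph.C ≃ Fin r)
    (hC : ∀ c', G.cuspGp c' = ((cuspInertia (g := g) (e c')).map ι).topologicalClosure)
    (ε : PuncturedSurfaceGroup g r)
    (hε : ε = ((List.finRange r).map fun j : Fin r =>
          if s ≤ (j : ℕ) then PuncturedSurfaceGroup.c (g := g) j else 1).prod *
        ((List.finRange g).map fun i : Fin g => if (i : ℕ) < g₀ then
          PuncturedSurfaceGroup.a (r := r) i * PuncturedSurfaceGroup.b i *
            (PuncturedSurfaceGroup.a i)⁻¹ * (PuncturedSurfaceGroup.b i)⁻¹ else 1).prod)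
    (n₀ : G.graph.N) (hN : ∀ n, n = n₀)
    (hE : G.nodeGp n₀ = ((Subgroup.zpowers ε).map ι).topologicalClosure) :
    G.EdgeLikeSeparatingCoverings := by
  classical
  subst hs
  obtain ⟨r', rfl⟩ : ∃ r', r = r' + 1 := ⟨r - 1, by omega⟩
  have hr' : 1 ≤ r' := by omega
  have hg : g₀ < g := by omega
  obtain ⟨ℓ, hℓS⟩ := hne
  have hℓ : ℓ.Prime := hprime ℓ hℓS
  -- the level exponent `n = ℓ²`
  have hℓ2 : 2 ≤ ℓ := hℓ.two_le
  have hn3 : 3 ≤ ℓ ^ 2 := by nlinarith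
  haveI : NeZero (ℓ ^ 2) := ⟨by positivity⟩
  haveI : Fact (1 < ℓ ^ 2) := ⟨by omega⟩
  obtain ⟨b₀, ha, hb, hc⟩ := exists_freeGroupBasis_elim_zero g r'
  -- the level character `a_{g₀} ↦ 1`
  obtain ⟨χ, hχa', hχb', hχc'⟩ := exists_handleCuspCharacter (g := g) (r := r' + 1) (n := ℓ ^ 2)
    (fun i => if (i : ℕ) = g₀ then 1 else 0) (fun _ => 0) (fun _ => 0) (by simp)
  have hχa : ∀ i : Fin g, χ (a i) = if (i : ℕ) = g₀ then ofAdd 1 else 1 := fun i => by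
    rw [hχa']; split_ifs <;> rfl
  have hχb : ∀ i : Fin g, χ (b i) = 1 := fun i => by rw [hχb']; rfl
  have hχc : ∀ j : Fin (r' + 1), χ (c j) = 1 := fun j => by rw [hχc']; rfl
  have ht : χ (a ⟨g₀, hg⟩) = ofAdd 1 := by rw [hχa, if_pos rfl]
  have hχbasis := levelCharacter_basis hg b₀ ha hb hc χ hχa hχb hχc
  obtain ⟨bK, hbK, hbKT⟩ :=
    FreeGroupBasis.exists_freeGroupBasis_cyclicKernel b₀ (Sum.inl (⟨g₀, hg⟩, false)) (ℓ ^ 2) χ hχbasis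
  -- the open level
  have hidx : Anabelioids.IsSigmaInteger Sigma χ.ker.index := by
    rw [FreeGroupBasis.index_cyclicKernel b₀ _ (ℓ ^ 2) χ hχbasis]
    exact isSigmaInteger_prime_pow hℓ hℓS 2
  obtain ⟨P₀, hP₀o, hP₀K⟩ := hι.comap_surj χ.ker inferInstance hidx
  haveI : P₀.Normal := normal_of_comap_normal hι P₀ hP₀o (by rw [hP₀K]; infer_instance)
  -- the node loop `ε = w⁻¹`
  set w : PuncturedSurfaceGroup g (r' + 1) := ((List.finRange g).map fun i : Fin g => if g₀ ≤ (i : ℕ) then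
    a (r := r' + 1) i * b i * (a i)⁻¹ * (b i)⁻¹ else 1).prod with hw
  have hεw : ε = w⁻¹ := nodeLoop_eq_inv_of_unmarked g₀ ε hε
  have hwK : w ∈ χ.ker := secondHandleProd_mem_levelKer χ hχb
  -- the edge generators
  obtain ⟨x, hxn, hxc⟩ : ∃ x : G.graph.N ⊕ G.graph.C → PuncturedSurfaceGroup g (r' + 1),
      (∀ n, x (Sum.inl n) = w) ∧ ∀ c', x (Sum.inr c') = c (e c') :=
    ⟨Sum.elim (fun _ => w) fun c' => c (e c'), fun _ => rfl, fun _ => rfl⟩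
  have hx : ∀ e', x e' ∈ χ.ker := by
    rintro (n | c')
    · rw [hxn]; exact hwK
    · rw [hxc]; exact c_mem_levelKer χ hχc _
  have hmod : ∀ m : ℕ, m < ℓ ^ 2 → m ≠ 0 → ((m : ℕ) : ZMod (ℓ ^ 2)) ≠ 0 := fun m hm hm0 h => by
    rw [ZMod.natCast_eq_zero_iff] at h
    exact hm0 (Nat.eq_zero_of_dvd_of_lt h hm)
  have hconj : ∀ {u : PuncturedSurfaceGroup g (r' + 1)}, u ∈ χ.ker → ∀ m : ℕ,
      a ⟨g₀, hg⟩ ^ m * u * (a ⟨g₀, hg⟩ ^ m)⁻¹ ∈ χ.ker := fun hu m => (MonoidHom.normal_ker χ).conj_mem _ hu _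
  have hc0K : c (g := g) (0 : Fin (r' + 1)) ∈ χ.ker := c_mem_levelKer χ hχc 0
  have hcsK : ∀ k : Fin r', c (g := g) (Fin.succ k) ∈ χ.ker := fun k => c_mem_levelKer χ hχc _
  refine G.edgeLikeSeparatingCoverings_of_levelCertificates hι hℓ hℓS P₀ hP₀o χ hP₀K (a ⟨g₀, hg⟩) ht x hx
    ?_ ?_ ?_
  · -- edge groups
    rintro (n | c')
    · change G.nodeGp n = _
      rw [hN n, hE, hεw, Subgroup.zpowers_inv, hxn]
    · change G.cuspGp c' = _
      rw [hC, hxc]; rfl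
  · -- level basis members
    rintro (n | c')
    · obtain ⟨b', hb', -⟩ := exists_levelBasis_secondHandleProd hg b₀ ha hb χ hχb bK hbK
      exact ⟨_, b', _, by rw [hb', hxn]⟩
    · rcases Fin.eq_zero_or_eq_succ (e c') with hj | ⟨k, hk⟩
      · obtain ⟨b', hb', -⟩ := exists_levelBasis_cuspZero hg b₀ ha hb hc χ hχb hχc bK hbK
        exact ⟨_, b', _, by rw [hb', hxc, hj]⟩
      · exact ⟨_, bK, Sum.inl (⟨Sum.inr k, by simp⟩, 0), by rw [levelBasis_zero_cusp hg b₀ hc χ bK hbK k, hxc, hk]⟩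
  · -- certificates
    intro e₁ e₂ m hm hne12
    rcases e₂ with n₂ | c₂ <;> rcases e₁ with n₁ | c₁
    · -- kill the node, keep a translate of the node: `m ≠ 0`
      have hm0 : m ≠ 0 := by
        rcases hne12 with h | h
        · exact absurd (by rw [hN n₁, hN n₂]) h
        · exact h
      exact exists_hom_congr_of_eq (hxn n₂) (by rw [hxn]) hwK (hconj hwK m)
        (exists_certificate_node_node hg b₀ ha hb hc χ hχa hχb hχc bK hbK hbKT hn3 m (hmod m hm hm0) hwK
          (hconj hwK m))
    · -- kill the node, keep a cusp
      rcases Fin.eq_zero_or_eq_succ (e c₁) with hj | ⟨k, hk⟩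
      · exact exists_hom_congr_of_eq (hxn n₂) (by rw [hxc, hj]) hwK (hconj hc0K m)
          (exists_certificate_node_cuspZero hg b₀ ha hb hc χ hχa hχb hχc bK hbK hbKT hn3 m (Or.inl hr') hwK
            (hconj hc0K m))
      · exact exists_hom_congr_of_eq (hxn n₂) (by rw [hxc, hk]) hwK (hconj (hcsK k) m)
          (exists_certificate_node_cuspSucc hg b₀ ha hb hc χ hχa hχb hχc bK hbK hbKT k m hwK (hconj (hcsK k) m))
    · -- kill a cusp, keep a translate of the node
      rcases Fin.eq_zero_or_eq_succ (e c₂) with hj | ⟨k₀, hk₀⟩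
      · exact exists_hom_congr_of_eq (by rw [hxc, hj]) (by rw [hxn]) hc0K (hconj hwK m)
          (exists_certificate_cuspZero_node hg b₀ ha hb hc χ hχa hχb hχc bK hbK hbKT hn3 m (Or.inl hr') hc0K
            (hconj hwK m))
      · exact exists_hom_congr_of_eq (by rw [hxc, hk₀]) (by rw [hxn]) (hcsK k₀) (hconj hwK m)
          (exists_certificate_cuspSucc_node hg b₀ ha hb hc χ hχa hχb hχc bK hbK hbKT hn3 k₀ m (hcsK k₀)
            (hconj hwK m))
    · -- kill a cusp, keep a translate of a cusp
      rcases Fin.eq_zero_or_eq_succ (e c₂) with hj₂ | ⟨k₀, hk₀⟩ <;>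
        rcases Fin.eq_zero_or_eq_succ (e c₁) with hj₁ | ⟨k, hk⟩
      · -- both `c_0`: `m ≠ 0`
        have hm0 : m ≠ 0 := by
          rcases hne12 with h | h
          · exact absurd (by rw [Sum.inr.injEq]; exact e.injective (hj₁.trans hj₂.symm)) h
          · exact h
        exact exists_hom_congr_of_eq (by rw [hxc, hj₂]) (by rw [hxc, hj₁]) hc0K (hconj hc0K m)
          (exists_certificate_cuspZero_cuspZero hg b₀ ha hb hc χ hχa hχb hχc bK hbK hbKT hn3 m (hmod m hm hm0)
            hc0K (hconj hc0K m))
      · exact exists_hom_congr_of_eq (by rw [hxc, hj₂]) (by rw [hxc, hk]) hc0K (hconj (hcsK k) m)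
          (exists_certificate_cuspZero_cuspSucc hg b₀ ha hb hc χ hχa hχb hχc bK hbK hbKT k m hc0K
            (hconj (hcsK k) m))
      · exact exists_hom_congr_of_eq (by rw [hxc, hk₀]) (by rw [hxc, hj₁]) (hcsK k₀) (hconj hc0K m)
          (exists_certificate_cuspSucc_cuspZero hg b₀ ha hb hc χ hχa hχb hχc bK hbK hbKT hn3 k₀ m (hcsK k₀)
            (hconj hc0K m))
      · have hne' : k ≠ k₀ ∨ ((m : ℕ) : ZMod (ℓ ^ 2)) ≠ 0 := by
          rcases hne12 with h | h
          · left
            rintro rfl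
            exact h (by rw [Sum.inr.injEq]; exact e.injective (hk.trans hk₀.symm))
          · exact Or.inr (hmod m hm h)
        exact exists_hom_congr_of_eq (by rw [hxc, hk₀]) (by rw [hxc, hk]) (hcsK k₀) (hconj (hcsK k) m)
          (exists_certificate_cuspSucc_cuspSucc hg b₀ ha hb hc χ hχa hχb hχc bK hbK hbKT k₀ k m hne' (hcsK k₀)
            (hconj (hcsK k) m))

end Datum

/-! ### Origin level -/

/-- **Row F-2827 `EdgeLikeSeparatingCoverings` at EVERY origin whose data are of two-component shape with
`C₁` unmarked and at least two marked points** (abc-iut-f-164 gen 2's origin hypothesis of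
`PSCTwoComponentUnmarkedOrigin.lean` BY NAME, with `2 ≤ r`). [cite: MochizukiCombGC2007, Prop 1.2 proof p.9] -/
theorem twoComponentUnmarkedOrigin_edgeLikeSeparatingCoverings (Ω : PSCOrigin.{0})
    (hΩ : ∀ ⦃Q : Type⦄ [Group Q] [TopologicalSpace Q] [IsTopologicalGroup Q] (G : PSCDatum Q),
      Ω.IsOfPSCType G → CompactSpace Q ∧ T2Space Q ∧ TotallyDisconnectedSpace Q ∧
        ∃ (S : Set ℕ) (g r g₀ s : ℕ) (ι : PuncturedSurfaceGroup g r →* Q) (e : G.graph.C ≃ Fin r)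
          (v₀ v₁ : G.graph.V) (n₀ : G.graph.N) (ε : PuncturedSurfaceGroup g r),
          S.Nonempty ∧ (∀ p ∈ S, p.Prime) ∧ IsProSigmaCompletion S ι ∧ g₀ ≤ g ∧ s = 0 ∧ 2 ≤ r ∧
          (1 ≤ g₀ ∨ 2 ≤ r) ∧ 1 ≤ g - g₀ ∧
          (∀ c, G.cuspGp c =
            ((PuncturedSurfaceGroup.cuspInertia (g := g) (e c)).map ι).topologicalClosure) ∧
          (∀ w, w = v₀ ∨ w = v₁) ∧ (∀ n, n = n₀) ∧
          ε = ((List.finRange r).map fun j : Fin r =>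
            if s ≤ (j : ℕ) then PuncturedSurfaceGroup.c (g := g) j else 1).prod *
          ((List.finRange g).map fun i : Fin g => if (i : ℕ) < g₀ then
            PuncturedSurfaceGroup.a (r := r) i * PuncturedSurfaceGroup.b i *
              (PuncturedSurfaceGroup.a i)⁻¹ * (PuncturedSurfaceGroup.b i)⁻¹ else 1).prod ∧
          G.vertGp v₀ = ((Subgroup.closure {x : PuncturedSurfaceGroup g r |
            (∃ i : Fin g, (i : ℕ) < g₀ ∧ (x = PuncturedSurfaceGroup.a i ∨ x = PuncturedSurfaceGroup.b i)) ∨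
            ∃ j : Fin r, s ≤ (j : ℕ) ∧ x = PuncturedSurfaceGroup.c j}).map ι).topologicalClosure ∧
          G.vertGp v₁ = ((Subgroup.closure {x : PuncturedSurfaceGroup g r |
            (∃ i : Fin g, g₀ ≤ (i : ℕ) ∧ (x = PuncturedSurfaceGroup.a i ∨ x = PuncturedSurfaceGroup.b i)) ∨
            (∃ j : Fin r, (j : ℕ) < s ∧ x = PuncturedSurfaceGroup.c j) ∨ x = ε}).map ι).topologicalClosure ∧
          G.nodeGp n₀ = ((Subgroup.zpowers ε).map ι).topologicalClosure ∧
          G.genus v₀ = g₀ ∧ G.genus v₁ = g - g₀) :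
    ∀ ⦃Q : Type⦄ [Group Q] [TopologicalSpace Q] [IsTopologicalGroup Q] (G : PSCDatum Q),
      Ω.IsOfPSCType G → G.EdgeLikeSeparatingCoverings := by
  intro Q _ _ _ G hG
  obtain ⟨hc, -, hd, S, g, r, g₀, s, ι, e, v₀, v₁, n₀, ε, hne, hprime, hι, hg₀, hs, hr, -, hg₁, hC, -, hN,
    hε, -, -, hE, -, -⟩ := hΩ G hG
  haveI := hc
  haveI := hd
  exact G.edgeLikeSeparatingCoverings_of_twoComponentUnmarked hne hprime ι hι hg₀ hs hr hg₁ e hC ε hε n₀ hN hE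

end PSCDatum

end Literature.AnabelianGeometry.SemiGraphs

end
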